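import Mathlib
import Literature.Computability.AlgebraicComplexity.HessianAtOrigin
import Summits.ValiantsHypothesis.ValiantsHypothesis.Theorems.GrenetZeonTwoDimCoefficientsScalingShadowFamily
import Summits.ValiantsHypothesis.ValiantsHypothesis.Theorems.GrenetZeonTwoDimCoefficientsScalingClosureShadow
import Summits.ValiantsHypothesis.ValiantsHypothesis.Theorems.GrenetZeonTwoDimCoefficientsScalingRayInterpolation
import Summits.ValiantsHypothesis.ValiantsHypothesis.Theorems.GrenetZeonTwoDimCoefficientsScalingCompanionDegree
import Literature.Computability.AlgebraicComplexity.MignonRessayreBound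

/-!
# Crux `GrenetZeon.TwoDimCoefficients` (stmt-ValiantsHypothesis-8062), stub `stub_dualUnipotent`:
# scaling-closure at ORDER TWO — `rank Hess per_n ≤ 4m` off the perfect-square locus

The first instance of the factor programme (memo SEVENTEENTH-HAND.md) that closes in the kernel.  Suppose the shadow of
a unipotent dual representation has only its order-two companion, `Φ = c + p + Ψ` (`p = β⁻¹per_n`, `Ψ = [D₂]_{2n}`; the
companions `[D_k]_{kn}`, `3 ≤ k ≤ m`, vanish and `deg D_k ≤ kn` — e.g. `m < 3n` with `deg D₂ ≤ 2n`, or a two-channel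
index-`n` pencil).  On the ray `t ↦ λ·z₀` the zeros of `Φ` are `λⁿ ∈ {t₁, t₂}`, the two roots of `c + tP + t²Q`
(`P = p(z₀)`, `Q = Ψ(z₀)`); they are SMOOTH zeros by Euler's identity whenever `t₁ ≠ t₂` (discriminant `P² − 4cQ ≠ 0`),
so Mignon–Ressayre on the shadow (✓ `rank_hess0_shadow_le`) bounds the two node matrices `Hess p(z₀) + t_i·Hess Ψ(z₀)`
by `2m`, and interpolating the two nodes:

* ★ `rank_hess0_perPoly_le_four_mul` — at every `z₀` with `Ψ(z₀) ≠ 0` and `p(z₀)² ≠ 4c·Ψ(z₀)`: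
  `rank Hess per_n(z₀) ≤ 4m`.

So off the hypersurface `p² = 4cΨ` the permanent's Hessian is `4m`-degenerate; if `p² − 4cΨ ≢ 0` (the shadow is NOT the
perfect square `c(1 + p/2c)²`) a generic point gives `n² ≤ 4m` — the crux's bound with `C = 4` on this class, modulo
the generic-point bookkeeping (`rank Hess per_n = n²` generically, tree: `rank_mrHess`) recorded in the memo.  The
perfect-square case `Ψ = p²/(4c)`, i.e. `[tr((adj A·B)²)]_{2n} = per_n²/(2β²)` by ✓ `homogeneousComponent_coeff_det_two_two_mul`,
is the exact residual at order two.

HONEST FRAMING: a pointwise Hessian bound on a sub-class; the stub `DualUnipotentBound`, the crux and `VP ≠ VNP`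
remain open.

References: T. Mignon, N. Ressayre, Int. Math. Res. Not. 2004:79, Thm. 1.1 (via the tree); folklore (Euler's identity).
-/

-- single-conjunct layout `Summits/ValiantsHypothesis/ValiantsHypothesis`: the duplicated namespace
-- component is mandated by the tree.
set_option linter.dupNamespace false
set_option autoImplicit false

noncomputable section

namespace Summit.ValiantsHypothesis.ValiantsHypothesis.Theorems.GrenetZeonTwoDimCoefficients.ScalingClosure

open MvPolynomial Matrix
open Literature.Computability.AlgebraicComplexity
open Summit.ValiantsHypothesis.ValiantsHypothesis.Cruxes.TwoDimCoefficients.DimTwoCases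

section Tools

variable {σ : Type*} [Fintype σ]

/-- **Euler at a point**: if all first partials of `G = c + g + h` (`g`, `h` forms of degrees `a`, `b`) vanish at `z`,
then `a·g(z) + b·h(z) = 0`. [folklore] -/
theorem euler_eval_eq_zero_of_pderiv_eq_zero (c : ℂ) (g h : MvPolynomial σ ℂ) {a b : ℕ} (hg : g.IsHomogeneous a)
    (hh : h.IsHomogeneous b) (z : σ → ℂ) (hz : ∀ i, eval z (pderiv i (MvPolynomial.C c + g + h)) = 0) :
    (a : ℂ) * eval z g + (b : ℂ) * eval z h = 0 := by
  have hsum : eval z (∑ i : σ, X i * pderiv i (MvPolynomial.C c + g + h)) = 0 := by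
    rw [map_sum]
    exact Finset.sum_eq_zero fun i _ => by rw [map_mul, hz i, mul_zero]
  have hexp : ∑ i : σ, X i * pderiv i (MvPolynomial.C c + g + h) =
      (a : MvPolynomial σ ℂ) * g + (b : MvPolynomial σ ℂ) * h := by
    simp_rw [map_add, pderiv_C, zero_add, mul_add, Finset.sum_add_distrib, hg.sum_X_mul_pderiv,
      hh.sum_X_mul_pderiv, nsmul_eq_mul]
  rw [hexp, map_add, map_mul, map_mul, map_natCast, map_natCast] at hsum
  exact hsum

variable [DecidableEq σ]

/-- Rank is unchanged by a non-zero scalar (the inequality we need). [folklore] -/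
theorem rank_le_rank_smul_of_ne_zero {a : ℂ} (ha : a ≠ 0) (M : Matrix σ σ ℂ) : M.rank ≤ (a • M).rank := by
  have h : M = a⁻¹ • (a • M) := by rw [smul_smul, inv_mul_cancel₀ ha, one_smul]
  conv_lhs => rw [h]
  exact rank_smul_le _ _

/-- **Two-node interpolation**: `rank(H + t₁K), rank(H + t₂K) ≤ ρ`, `t₁ ≠ t₂` ⟹ `rank H ≤ 2ρ`. [folklore] -/
theorem rank_le_of_two_nodes (H K : Matrix σ σ ℂ) {t₁ t₂ : ℂ} (ht : t₁ ≠ t₂) (ρ : ℕ) (h1 : (H + t₁ • K).rank ≤ ρ)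
    (h2 : (H + t₂ • K).rank ≤ ρ) : H.rank ≤ 2 * ρ := by
  have e : (t₂ - t₁) • H = t₂ • (H + t₁ • K) + (-t₁) • (H + t₂ • K) := by
    ext i j
    simp only [Matrix.smul_apply, Matrix.add_apply, smul_eq_mul]
    ring
  have hne : t₂ - t₁ ≠ 0 := sub_ne_zero.mpr (Ne.symm ht)
  calc H.rank ≤ ((t₂ - t₁) • H).rank := rank_le_rank_smul_of_ne_zero hne H
    _ ≤ (t₂ • (H + t₁ • K)).rank + ((-t₁) • (H + t₂ • K)).rank := by rw [e]; exact rank_add_le_rank_add _ _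
    _ ≤ ρ + ρ := Nat.add_le_add ((rank_smul_le _ _).trans h1) ((rank_smul_le _ _).trans h2)
    _ = 2 * ρ := by ring

omit [Fintype σ] [DecidableEq σ] in
/-- The two roots `t = (−P ± s)/(2Q)` of `c + tP + t²Q` (`s² = P² − 4cQ`, `Q ≠ 0`), with the derivative `P + 2tQ = ±s`.
[folklore] -/
theorem quadratic_root_aux (c P Q s ε : ℂ) (hQ : Q ≠ 0) (hs : s ^ 2 = P ^ 2 - 4 * c * Q) (hε : ε ^ 2 = 1) :
    c + (-P + ε * s) / (2 * Q) * P + ((-P + ε * s) / (2 * Q)) ^ 2 * Q = 0 ∧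
      P + 2 * ((-P + ε * s) / (2 * Q)) * Q = ε * s := by
  constructor
  · have h : c + (-P + ε * s) / (2 * Q) * P + ((-P + ε * s) / (2 * Q)) ^ 2 * Q =
        (s ^ 2 * (ε ^ 2 - 1) + (s ^ 2 - (P ^ 2 - 4 * c * Q))) / (4 * Q) := by
      field_simp
      ring
    rw [h, hε, hs]
    ring
  · field_simp
    ring

end Tools

section OrderTwo

/-- ★ **Order-two scaling closure: `rank Hess per_n(z₀) ≤ 4m` off the perfect-square locus.**  Let
`per_n = α·c + β·tr(adj A·B)` be a unipotent dual representation (`det A = c ≠ 0`, `A, B` affine `m × m`, `n ≥ 2`, `m ≥ 2`)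
with `deg D_k ≤ k·n` (`k ≥ 2`) and vanishing companions of order `3 ≤ k ≤ m`, and put `p = β⁻¹per_n`, `Ψ = [D₂]_{2n}`.
Then at every point `z₀` with `Ψ(z₀) ≠ 0` and `p(z₀)² − 4c·Ψ(z₀) ≠ 0`: `rank Hess per_n(z₀) ≤ 4m`.
[cite: MignonRessayre2004, Thm. 1.1 — via the tree; folklore] -/
theorem rank_hess0_perPoly_le_four_mul {n m : ℕ} (A B : AffMat n m) (hA : IsAffine A) (hB : IsAffine B)
    (α β c : ℂ) (hc : c ≠ 0) (hβ : β ≠ 0) (hdet : A.det = MvPolynomial.C c)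
    (hper : perPoly (Fin n) ℂ = MvPolynomial.C α * A.det + MvPolynomial.C β * (A.adjugate * B).trace)
    (hn : 2 ≤ n) (hm2 : 2 ≤ m) (D : ℕ → MvPolynomial (Fin n × Fin n) ℂ)
    (hD : ∀ k, D k = (det ((Polynomial.X : Polynomial (MvPolynomial (Fin n × Fin n) ℂ)) •
      B.map Polynomial.C + A.map Polynomial.C)).coeff k)
    (hdeg : ∀ k, 2 ≤ k → ∀ d, k * n < d → homogeneousComponent d (D k) = 0)
    (hJ2 : ∀ k, 3 ≤ k → k ≤ m → homogeneousComponent (k * n) (D k) = 0)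
    (z₀ : Fin n × Fin n → ℂ)
    (hQ : eval z₀ (homogeneousComponent (2 * n) (D 2)) ≠ 0)
    (hdisc : (eval z₀ (MvPolynomial.C β⁻¹ * perPoly (Fin n) ℂ)) ^ 2 -
      4 * c * eval z₀ (homogeneousComponent (2 * n) (D 2)) ≠ 0) :
    (hess0 (transl z₀ (perPoly (Fin n) ℂ))).rank ≤ 4 * m := by
  classical
  set p : MvPolynomial (Fin n × Fin n) ℂ := MvPolynomial.C β⁻¹ * perPoly (Fin n) ℂ with hp
  set Ψ : MvPolynomial (Fin n × Fin n) ℂ := homogeneousComponent (2 * n) (D 2) with hΨ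
  set Φ : MvPolynomial (Fin n × Fin n) ℂ := MvPolynomial.C c + p + Ψ with hΦ
  -- homogeneity
  have hp_hom : p.IsHomogeneous n := by
    have h := (perPoly_isHomogeneous (n := Fin n) (k := ℂ))
    rw [Fintype.card_fin] at h
    simpa only [hp, zero_add] using (isHomogeneous_C _ β⁻¹).mul h
  have hΨ_hom : Ψ.IsHomogeneous (2 * n) := homogeneousComponent_isHomogeneous _ _
  -- the shadow of the representation is `Φ`
  obtain ⟨Pf, h0, hMR⟩ := exists_shadowFamily A B hA hB α β c hc hβ hdet hper (by omega) hm2 D hD hdeg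
  have hsum : (∑ k ∈ Finset.range (m + 1), if 2 ≤ k then homogeneousComponent (k * n) (D k) else 0) = Ψ := by
    rw [Finset.sum_eq_single 2]
    · simp [hΨ]
    · intro k hk hk2
      split_ifs with h2
      · exact hJ2 k (by omega) (by simpa [Finset.mem_range, Nat.lt_succ_iff] using hk)
      · rfl
    · intro h; exact absurd (Finset.mem_range.mpr (by omega)) h
  have h0' : ∀ z : Fin n × Fin n → ℂ, eval (fun o : Option (Fin n × Fin n) => o.elim (0 : ℂ) z) Pf = eval z Φ := by
    intro z; rw [h0 z, hsum]
  -- Mignon–Ressayre on the shadow at smooth zeros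
  have hnode : ∀ z, eval z Φ = 0 → (∃ i, eval z (pderiv i Φ) ≠ 0) → (hess0 (transl z Φ)).rank ≤ 2 * m := by
    rintro z hz ⟨i, hi⟩
    exact rank_hess0_shadow_le Pf Φ (2 * m) h0' hMR z hz i hi
  -- the two roots of `c + tP + t²Q`
  set P := eval z₀ p with hPdef
  set Q := eval z₀ Ψ with hQdef
  obtain ⟨s, hs⟩ := IsAlgClosed.exists_pow_nat_eq (P ^ 2 - 4 * c * Q) (by norm_num : 0 < 2)
  have hs0 : s ≠ 0 := by rintro rfl; exact hdisc (by rw [← hs]; ring)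
  -- for each root: a ray node
  have hroot : ∀ ε : ℂ, ε ^ 2 = 1 →
      c + (-P + ε * s) / (2 * Q) * P + ((-P + ε * s) / (2 * Q)) ^ 2 * Q = 0 ∧
        P + 2 * ((-P + ε * s) / (2 * Q)) * Q = ε * s ∧ (-P + ε * s) / (2 * Q) ≠ 0 := by
    intro ε hε
    obtain ⟨h1, h2⟩ := quadratic_root_aux c P Q s ε hQ hs hε
    refine ⟨h1, h2, fun ht => hc ?_⟩
    rw [ht] at h1
    simpa using h1
  have hray : ∀ t : ℂ, c + t * P + t ^ 2 * Q = 0 → P + 2 * t * Q ≠ 0 → t ≠ 0 →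
      (hess0 (transl z₀ p) + t • hess0 (transl z₀ Ψ)).rank ≤ 2 * m := by
    intro t ht hder ht0
    obtain ⟨l, hl⟩ := IsAlgClosed.exists_pow_nat_eq t (by omega : 0 < n)
    have hl0 : l ≠ 0 := by rintro rfl; rw [zero_pow (by omega)] at hl; exact ht0 hl.symm
    -- value and smoothness at `l • z₀`
    have hval : eval (l • z₀) Φ = 0 := by
      have hl2 : l ^ (2 * n) = t ^ 2 := by rw [pow_mul', hl]
      rw [hΦ, map_add, map_add, MvPolynomial.eval_C, eval_smul_of_isHomogeneous _ hp_hom,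
        eval_smul_of_isHomogeneous _ hΨ_hom, hl2, hl, ← hPdef, ← hQdef, ← ht]
    have hsmooth : ∃ i, eval (l • z₀) (pderiv i Φ) ≠ 0 := by
      by_contra hno
      push Not at hno
      have hl2 : l ^ (2 * n) = t ^ 2 := by rw [pow_mul', hl]
      have he := euler_eval_eq_zero_of_pderiv_eq_zero c p Ψ hp_hom hΨ_hom (l • z₀) hno
      rw [eval_smul_of_isHomogeneous _ hp_hom, eval_smul_of_isHomogeneous _ hΨ_hom, hl2, hl, ← hPdef,
        ← hQdef, Nat.cast_mul, Nat.cast_two] at he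
      have h' : (n : ℂ) * t * (P + 2 * t * Q) = 0 := by linear_combination he
      rcases mul_eq_zero.mp h' with h | h
      · rcases mul_eq_zero.mp h with h | h
        · exact absurd h (Nat.cast_ne_zero.mpr (by omega))
        · exact ht0 h
      · exact hder h
    have hrk := hnode _ hval hsmooth
    -- Hessian along the ray
    have hH : hess0 (transl (l • z₀) Φ) = l ^ (n - 2) • (hess0 (transl z₀ p) + t • hess0 (transl z₀ Ψ)) := by
      rw [hΦ, add_assoc, hess0_transl_C_add, map_add, map_add, hess0_transl_smul_of_isHomogeneous p hp_hom,
        hess0_transl_smul_of_isHomogeneous Ψ hΨ_hom, smul_add, smul_smul, ← hl, ← pow_add,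
        show n - 2 + n = 2 * n - 2 by omega]
    rw [hH] at hrk
    exact (rank_le_rank_smul_of_ne_zero (pow_ne_zero _ hl0) _).trans hrk
  -- the two nodes
  obtain ⟨h1a, h1b, h1c⟩ := hroot 1 (by norm_num)
  obtain ⟨h2a, h2b, h2c⟩ := hroot (-1) (by norm_num)
  have hne : (-P + 1 * s) / (2 * Q) ≠ (-P + -1 * s) / (2 * Q) := by
    intro h
    rw [div_left_inj' (mul_ne_zero two_ne_zero hQ)] at h
    exact hs0 (by linear_combination h / 2)
  have hHp := rank_le_of_two_nodes (hess0 (transl z₀ p)) (hess0 (transl z₀ Ψ)) hne (2 * m)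
    (hray _ h1a (by rw [h1b]; simpa using hs0) h1c) (hray _ h2a (by rw [h2b]; simpa using hs0) h2c)
  -- `Hess p = β⁻¹ • Hess per`
  have hpH : hess0 (transl z₀ p) = β⁻¹ • hess0 (transl z₀ (perPoly (Fin n) ℂ)) := by
    rw [hp, map_mul, transl_C, hess0_C_mul]
  rw [hpH] at hHp
  exact (rank_le_rank_smul_of_ne_zero (inv_ne_zero hβ) _).trans (hHp.trans (by omega))

/-- ★★ **Order-two scaling closure, counting form: `n² ≤ 4m` unless the shadow is a perfect square.**  In the situation
of `rank_hess0_perPoly_le_four_mul` (`n = k + 3`), if the discriminant polynomial `p² − 4c·Ψ` is not identically zero —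
i.e. the shadow `c + p + Ψ` is not the square `c(1 + p/2c)²` — then `n² ≤ 4m`.  (If `Ψ = 0` the representation is
companion-free and ✓ `sq_le_two_mul_of_companionFree` gives `n² ≤ 2m`; otherwise a generic point — off `Ψ = 0`, off the
discriminant, and where `Hess per_n` is non-degenerate, which exists by the Mignon–Ressayre point ✓ `rank_mrHess` —
feeds the pointwise bound.) [cite: MignonRessayre2004, Thm. 1.1 — via the tree; folklore] -/
theorem sq_le_four_mul_of_orderTwo {k m : ℕ} (A B : AffMat (k + 3) m) (hA : IsAffine A) (hB : IsAffine B)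
    (α β c : ℂ) (hc : c ≠ 0) (hβ : β ≠ 0) (hdet : A.det = MvPolynomial.C c)
    (hper : perPoly (Fin (k + 3)) ℂ =
      MvPolynomial.C α * A.det + MvPolynomial.C β * (A.adjugate * B).trace)
    (hm2 : 2 ≤ m) (D : ℕ → MvPolynomial (Fin (k + 3) × Fin (k + 3)) ℂ)
    (hD : ∀ j, D j = (det ((Polynomial.X : Polynomial (MvPolynomial (Fin (k + 3) × Fin (k + 3)) ℂ)) •
      B.map Polynomial.C + A.map Polynomial.C)).coeff j)
    (hdeg : ∀ j, 2 ≤ j → ∀ d, j * (k + 3) < d → homogeneousComponent d (D j) = 0)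
    (hJ2 : ∀ j, 3 ≤ j → j ≤ m → homogeneousComponent (j * (k + 3)) (D j) = 0)
    (hdisc : (MvPolynomial.C β⁻¹ * perPoly (Fin (k + 3)) ℂ) ^ 2 -
      MvPolynomial.C (4 * c) * homogeneousComponent (2 * (k + 3)) (D 2) ≠ 0) :
    (k + 3) ^ 2 ≤ 4 * m := by
  classical
  by_cases hΨ0 : homogeneousComponent (2 * (k + 3)) (D 2) = 0
  · -- companion-free
    have h2 : (k + 3) ^ 2 ≤ 2 * m := by
      refine sq_le_two_mul_of_companionFree A B hA hB α β c hc hβ hdet hper hm2 D hD ?_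
      intro j hj d hd
      rcases hd.eq_or_lt with h | h
      · rw [← h]
        by_cases hj2 : j = 2
        · subst hj2; exact hΨ0
        · by_cases hjm : j ≤ m
          · exact hJ2 j (by omega) hjm
          · refine homogeneousComponent_eq_zero _ _ ?_
            have hdeg' := totalDegree_coeff_det_le A B hA hB j
            rw [Fintype.card_fin, ← hD] at hdeg'
            have : m < j * (k + 3) := by nlinarith
            omega
      · exact hdeg j hj d h
    omega
  · -- a generic point
    set Hmat : Matrix (Fin (k + 3) × Fin (k + 3)) (Fin (k + 3) × Fin (k + 3))
        (MvPolynomial (Fin (k + 3) × Fin (k + 3)) ℂ) :=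
      Matrix.of fun s t => pderiv s (pderiv t (perPoly (Fin (k + 3)) ℂ)) with hHmat
    have hH : ∀ z : Fin (k + 3) × Fin (k + 3) → ℂ,
        hess0 (transl z (perPoly (Fin (k + 3)) ℂ)) = (MvPolynomial.eval z).mapMatrix Hmat := by
      intro z
      ext s t
      rw [hess0_transl, RingHom.mapMatrix_apply, Matrix.map_apply, hHmat, Matrix.of_apply]
    have hDper : Hmat.det ≠ 0 := by
      intro h0
      have h := RingHom.map_det (MvPolynomial.eval (mrPoint ℂ k)) Hmat
      rw [h0, map_zero, ← hH, hess0_transl_mrPoint_perPoly, Matrix.det_smul] at h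
      refine (mul_ne_zero (pow_ne_zero _ (Nat.cast_ne_zero.mpr (Nat.factorial_ne_zero k))) ?_) h.symm
      exact ((Matrix.isUnit_iff_isUnit_det _).mp
        (Matrix.mulVec_injective_iff_isUnit.mp mrHess_mulVec_injective)).ne_zero
    have hT : Hmat.det * homogeneousComponent (2 * (k + 3)) (D 2) *
        ((MvPolynomial.C β⁻¹ * perPoly (Fin (k + 3)) ℂ) ^ 2 -
          MvPolynomial.C (4 * c) * homogeneousComponent (2 * (k + 3)) (D 2)) ≠ 0 :=
      mul_ne_zero (mul_ne_zero hDper hΨ0) hdisc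
    obtain ⟨z₀, hz₀⟩ : ∃ z₀ : Fin (k + 3) × Fin (k + 3) → ℂ,
        eval z₀ (Hmat.det * homogeneousComponent (2 * (k + 3)) (D 2) *
          ((MvPolynomial.C β⁻¹ * perPoly (Fin (k + 3)) ℂ) ^ 2 -
            MvPolynomial.C (4 * c) * homogeneousComponent (2 * (k + 3)) (D 2))) ≠ 0 := by
      by_contra hall
      push Not at hall
      exact hT (MvPolynomial.funext fun z => by rw [hall z, map_zero])
    rw [map_mul, map_mul] at hz₀
    obtain ⟨⟨hz1, hz2⟩, hz3⟩ := mul_ne_zero_iff.mp hz₀ |>.imp_left (mul_ne_zero_iff.mp)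
    have hz3' : (eval z₀ (MvPolynomial.C β⁻¹ * perPoly (Fin (k + 3)) ℂ)) ^ 2 -
        4 * c * eval z₀ (homogeneousComponent (2 * (k + 3)) (D 2)) ≠ 0 := by
      have e : eval z₀ ((MvPolynomial.C β⁻¹ * perPoly (Fin (k + 3)) ℂ) ^ 2 -
          MvPolynomial.C (4 * c) * homogeneousComponent (2 * (k + 3)) (D 2)) =
          (eval z₀ (MvPolynomial.C β⁻¹ * perPoly (Fin (k + 3)) ℂ)) ^ 2 -
            4 * c * eval z₀ (homogeneousComponent (2 * (k + 3)) (D 2)) := by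
        rw [map_sub, map_pow, map_mul (eval z₀) (MvPolynomial.C (4 * c)), MvPolynomial.eval_C]
      rw [e] at hz3
      exact hz3
    have hrank := rank_hess0_perPoly_le_four_mul A B hA hB α β c hc hβ hdet hper (by omega) hm2 D hD hdeg hJ2
      z₀ hz2 hz3'
    have hfull : (hess0 (transl z₀ (perPoly (Fin (k + 3)) ℂ))).rank = (k + 3) ^ 2 := by
      have hu : IsUnit (hess0 (transl z₀ (perPoly (Fin (k + 3)) ℂ))) := by
        rw [Matrix.isUnit_iff_isUnit_det, hH, ← RingHom.map_det]
        exact isUnit_iff_ne_zero.mpr hz1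
      rw [Matrix.rank_of_isUnit _ hu, Fintype.card_prod, Fintype.card_fin, sq]
    rw [hfull] at hrank
    exact hrank

end OrderTwo

end Summit.ValiantsHypothesis.ValiantsHypothesis.Theorems.GrenetZeonTwoDimCoefficients.ScalingClosure

end
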